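import Mathlib
import HarnessLib
import HarnessLib.Audit
import Summits.Schanuel.Statement
import Literature.Dynamics.ExponentialFamily.PostsingularlyFinite
import HarnessLib.Audit.Status.Attr

/-!
Route: MisiurewiczField

DORMANT since 2026-08-22T16:51:35Z (reconciler: no traction for 5.5 d (last activity item-evidence-added at 2026-08-17T04:18:53Z); parked, not closed — `ledger route dormant route-Schanuel-MisiurewiczField --off` to reactivate) — unstaffed, not closed; items shared with open routes are served there. `ledger route dormant <id> --off` reactivates.

# Route MisiurewiczField — Schanuel = (Schanuel on the Misiurewicz sector of λe^z) + (Schanuel over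
the Misiurewicz field); attack the sector by dynamical André–Oort

Card Schanuel/Schanuel/exponential-family-misiurewicz-andre-oort (gen-2, conforming: the glue
decides `_root_.Schanuel`). Write E_l(z) = l·e^z,
a_j(l) = E_l^[j](0) (`Literature.Dynamics.ExponentialFamily.postsingularOrbit l j`); l is a
MISIUREWICZ (post-singularly finite) parameter iff
l ≠ 0 and a_n(l) = a_m(l) for some m < n (`IsPostsingularlyFinite l`). Let M ⊂ ℂ be the set of all
post-singular orbit points a_j(l), j ≥ 1, of all
Misiurewicz parameters l (M ∋ 2πik, W_b(2πik), …; e^w ∈ ℚ(M) for every w ∈ M because e^{a_j} =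
a_{j+1}/a_1), and K₀ := ℚ(M) the MISIUREWICZ FIELD.
X = X1 ∧ X2 ("it suffices to show X"): X1 = MisiurewiczSector — Schanuel's conjecture for tuples in
the ℚ-span of M (the card's POINT RESIDUE in
full: every algebraic relation among Misiurewicz orbit data is ℚ-linear in origin; "is 1 + 2πi a
Misiurewicz parameter?" lives here); X2 =
OffMisiurewiczSector — Schanuel RELATIVE to K₀: x₁…xₙ ℚ-independent modulo span M ⇒ trdeg_{K₀} K₀(x,
eˣ) ≥ n. X1 ∧ X2 ⇒ Schanuel (Assembly,
basis split + tower additivity) and Schanuel ⇒ X1 ∧ X2 (support SchanuelGivesSectors), so X ⟺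
Schanuel; the staffed content is the DYNAMICAL
ANDRÉ–OORT LADDER strictly below X1 (DAOExp finiteness, AddressSparsity, HeightOneLines) and the
provable-now cells.
Lean: `(∀ (n : ℕ) (x : Fin n → ℂ), (∀ i, x i ∈ Submodule.span ℚ {w : ℂ | ∃ l : ℂ,
Literature.Dynamics.ExponentialFamily.IsPostsingularlyFinite l ∧ ∃ j : ℕ, w =
Literature.Dynamics.ExponentialFamily.postsingularOrbit l (j + 1)}) → LinearIndependent ℚ x → (n :
Cardinal) ≤ Algebra.trdeg ℚ ↥(IntermediateField.adjoin ℚ (Set.range x ∪ Set.range (Complex.exp ∘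
x)))) ∧ (∀ (n : ℕ) (x : Fin n → ℂ), LinearIndependent ℚ ((Submodule.span ℚ {w : ℂ | ∃ l : ℂ,
Literature.Dynamics.ExponentialFamily.IsPostsingularlyFinite l ∧ ∃ j : ℕ, w =
Literature.Dynamics.ExponentialFamily.postsingularOrbit l (j + 1)}).mkQ ∘ x) → (n : Cardinal) ≤
Algebra.trdeg ↥(IntermediateField.adjoin ℚ {w : ℂ | ∃ l : ℂ,
Literature.Dynamics.ExponentialFamily.IsPostsingularlyFinite l ∧ ∃ j : ℕ, w =
Literature.Dynamics.ExponentialFamily.postsingularOrbit l (j + 1)}) ↥(IntermediateField.adjoin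
↥(IntermediateField.adjoin ℚ {w : ℂ | ∃ l : ℂ,
Literature.Dynamics.ExponentialFamily.IsPostsingularlyFinite l ∧ ∃ j : ℕ, w =
Literature.Dynamics.ExponentialFamily.postsingularOrbit l (j + 1)}) (Set.range x ∪ Set.range
(Complex.exp ∘ x))))`

## Assembly
Provable bookkeeping (difficulty M in Lean; kinds: basis completion, tower additivity of
`Algebra.trdeg`, monotonicity of trdeg under base
extension). Given ℚ-independent z₁…zₙ, let V = span z, W = V ∩ span M (dim k); pick a basis w of W
and complete by u to a basis of V, so u is
ℚ-independent modulo span M. ℚ(z, e^z) and ℚ(w, u, e^w, e^u) have the same algebraic closure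
(rational change of basis; rational exponents cost
only roots). MisiurewiczSector at w gives trdeg ℚ(w, e^w) ≥ k; e^w is algebraic over K₀ = ℚ(M) (w ∈
span M and e^m = a_{j+1}/a_1 ∈ K₀ for
m = a_j ∈ M), so trdeg_{ℚ(w,e^w)} ℚ(w,e^w)(u,e^u) ≥ trdeg_{K₀(w,e^w)} ≥ trdeg_{K₀} K₀(u,e^u) ≥ n − k
by OffMisiurewiczSector; additivity gives
trdeg ℚ(z,e^z) ≥ n. The deciding theorem `closes (hAssembly) (hMis) (hOff) : _root_.Schanuel :=
hAssembly hMis hOff` is in glue.lean.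

Rationale: WHY THIS LINE. Transplant of the dynamical André–Oort template (BakerDemarco2011; GhiocaEtAl2017 for
z^d + c) to the transcendental family λe^z with an explicit
dictionary: PCF parameter ↦ post-singularly finite parameter (classified by integer external
addresses, LaubnerSchleicherVicol2008; Thurston-rigid,
HubbardSchleicherShishikura2009; counted by Bergweiler2016); "special points are algebraic" ↦
"Misiurewicz orbit points are Khovanskii points over
ker exp = 2πiℤ", i.e. a combinatorially indexed sub-tree of Kirby's countable core ecl(∅) on which
Schanuel lives (tree theorems
`schanuelConjecture_iff_ecl_empty_holds`, `kirby_relative_schanuel_complex_holds`, Kirby2010EAEF);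
special curves ↦ lines y = r x, r ∈ ℚ.
The deciding frame is the sector/relative-complement split of LogPatterns with the log lattice
replaced by the MISIUREWICZ SPAN: because
e^{a_j} = a_{j+1}/a_1, the partial exponential on span_ℚ M lands in K₀^alg, which is exactly what
makes X1 ∧ X2 ⇒ Schanuel provable bookkeeping
and Schanuel ⇒ X2 a directed-union argument. Imported areas: arithmetic dynamics (special-point
format, finiteness-vs-emptiness split,
transversality from Thurston rigidity: arXiv:1902.06732, arXiv:1602.05172, arXiv:0907.5460),
o-minimal counting on INTEGER ADDRESSES via the
window trick (PilaWilkie2006, BinyaminiEtAl2026), classical transcendence PROVED in the tree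
(transcendental_pi, Hermite–Lindemann,
Lindemann–Weierstrass, Gel'fond–Schneider, Baker) for the unconditional cells;
DaquinoFornasieroTerzo2017 (generic solutions of iterated-exponential
equations under SC) is the phase-space twin of X1. What it does that prior routes do not:
DiophantineCore/RigidCore/ArithmeticalComplexity localise
Schanuel to the core abstractly; this line names an explicit, dynamically meaningful part of the
core, states the André–Oort-shaped FAMILY
theorems (finiteness, sparsity) that are attackable now, proves the point version is forced by X1
(SectorGivesEmptiness) and isolates the
height ≤ 1 cells that fall to HL/LW today (NoAlgebraicMisiurewiczLowType, ShallowHeightOneLines,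
LambertPairsShiftedDiagonal, KernelPairs).

RANKED CRUXES. #2 MisiurewiczSector (crux) — Schanuel's conjecture for tuples x₁…xₙ in the ℚ-span of
the Misiurewicz orbit set M (card POINT RESIDUE in full; contains orbit freeness, "no two
Misiurewicz parameters are algebraically dependent beyond ℚ-scaling", "1 + 2πik is never
Misiurewicz"). [difficulty: open-problem] (why it might fail: from tower height 2 on (types (4,·)
and deeper) these are genuine Schanuel instances about 2πi, W_b(2πik), e^{W…} with no method beyond
LW/Baker; one algebraic coincidence between two deep Misiurewicz parameters refutes it (and
Schanuel).) [DaquinoFornasieroTerzo2017, Kirby2010EAEF, LaubnerSchleicherVicol2008, Waldschmidt2000]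
#3 DAOExp (crux) — dynamical André–Oort for the exponential family over ℚ̄, FAMILY version (card
C1): for P ∈ ℚ̄[X,Y] irreducible, not associated to Y − rX (r ∈ ℚ), X − c or Y − c, only finitely
many pairs of Misiurewicz parameters lie on P = 0 (special curves = lines through 0 of rational
slope; axis-parallel lines excluded so that no point statement is smuggled in). Strictly below
MisiurewiczSector (SectorGivesEmptiness gives emptiness). [deps: AddressSparsity, HeightOneLines]
[difficulty: open-problem] (why it might fail: no Galois orbits: counting gives sparsity only, and
off the lattice/size regimes each cell asks to confine many ℚ-independent λ with λ, e^λ algebraic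
over ℚ(π, e^c) — the trdeg ≥ 2 wall (barrier LargeTranscendenceDegree).) [GhiocaEtAl2017,
BakerDemarco2011, LaubnerSchleicherVicol2008, Bergweiler2016]
#4 AddressSparsity (crux) — Pila–Wilkie sparsity (card C2) in the orbit-modulus normalisation: for P
as in DAOExp, every d and ε > 0 there is κ with #{(λ,λ′) on P = 0 : both Misiurewicz of type ≤ d
with all orbit points of modulus ≤ R} ≤ κ R^ε for R ≥ 1 (window trick a_j = x_j + i(y_j + 2πb_j)
makes type-(n,m) parameters the integer points of an ℝ_an,exp-definable set; orbit modulus ≤ R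
bounds address height; Pila–Wilkie thins the transcendental part; the algebraic part is classified
by an Ax–Lindemann lemma for twisted towers and emptied by KernelPairs). [deps: KernelPairs]
[difficulty: XL] (why it might fail: the algebraic part of Y_P may contain a non-special
semialgebraic family of twisted towers carrying integer points (an unforeseen functional identity
along an algebraic arc of addresses); and the Lean closure needs o-minimality + Pila–Wilkie, absent
from the tree.) [PilaWilkie2006, BinyaminiEtAl2026, Pila2022, Ax1971, LaubnerSchleicherVicol2008]
#5 HeightOneLines (crux) — the height-one table on lines (card C3): for algebraic a ≠ 0, c with (c ≠
0 or a ∉ ℚ), only finitely many λ have both λ and aλ + c Misiurewicz of type n ≤ 3 (λ ∈ πiℤ∖0, or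
λe^λ ∈ 2πiℤ, or λ(e^λ − 1) ∈ 2πiℤ). The proved cells ride as supports (ShallowHeightOneLines,
LambertPairsShiftedDiagonal); the residual cells are (3,·)×(3,·) with a ≠ 1: explicit
exponential-Diophantine equations with λ quadratic over ℚ(π, e^c), to be closed by
Lambert/transseries asymptotics in the integer data. [deps: ShallowHeightOneLines,
LambertPairsShiftedDiagonal] [difficulty: L] (why it might fail: for a ∉ {0,1} the solutions are
algebraic over ℚ(π, e^c) but span no lattice, so π-elimination fails and finiteness asks to confine
≥ 3 ℚ-independent λ_j with e^{λ_j} in a trdeg-2 field — Schneider–Lang over a field of finite type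
with no known transcendence type.) [Waldschmidt2000, BakerTNT1975, Gelfond1934, Bergweiler2016]
#6 OffMisiurewiczSector (crux) — Schanuel RELATIVE to the Misiurewicz field K₀ = ℚ(M): if x₁…xₙ ∈ ℂ
are ℚ-linearly independent modulo span_ℚ M then trdeg over K₀ of K₀(x, eˣ) is ≥ n. The complement of
the sector (contains: e transcendental over K₀ ∋ π; log 2 ∉ K₀^alg); by Kirby's PROVED relative
theorem (tree `kirby_relative_schanuel_complex_holds`) its content is carried by core tuples modulo
the Misiurewicz span. Schanuel ⇒ it (SchanuelGivesSectors) and X1 ∧ it ⇒ Schanuel (Assembly).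
[difficulty: open-problem] (why it might fail: it is most of Schanuel (x = (1) says e is
transcendental over ℚ(M) ∋ π; x = (log 2) says log 2 ∉ ℚ(M)^alg) and no transcendence method works
relative to the infinitely generated base ℚ(M); the route offers no attack on it beyond Kirby's
relative theorem.) [Kirby2010EAEF, BaysKirby2018, Waldschmidt2000, Lang1966]
#9 SectorGivesEmptiness (support) — the point version is forced by the sector: MisiurewiczSector ⇒
for P ≠ 0 with algebraic coefficients and no factor Y − rX (r ∈ ℚ), NO pair of Misiurewicz
parameters lies on P = 0 (so DAOExp's set is empty, not just finite; P = X − c: no Misiurewicz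
parameter is algebraic; P = Y − X − c: no two differ by an algebraic number). Proof: S = the two
orbits; e^{a_j} = a_{j+1}/λ ∈ ℚ(S); a ℚ-basis x ⊆ S of span S has trdeg ℚ(x) = trdeg ℚ(x, eˣ) ≥ |x|
by the sector, so x is algebraically independent; P(ℓ(x), ℓ′(x)) = 0 for the ℚ-linear forms of λ, λ′
forces ℓ′ = rℓ and (Y − rX) | P. [difficulty: M] [DaquinoFornasieroTerzo2017, Lang1966,
Waldschmidt2000]
#9 OrbitFreenessOfSector (support) — the orbit form of the sector ("the post-singular orbit of a
Misiurewicz exponential map is algebraically free"): MisiurewiczSector ⇒ for l of exact type (k,p),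
if the distinct orbit points a_1(l), …, a_{k+p−1}(l) are ℚ-linearly independent they are
algebraically independent (e^{a_j} = a_{j+1}/a_1 ∈ ℚ(a), so trdeg ℚ(a) = trdeg ℚ(a, e^a) ≥ k + p −
1). [difficulty: provable-now] [DaquinoFornasieroTerzo2017, Bergweiler2016]
#9 SchanuelGivesSectors (support) — Schanuel ⇒ MisiurewiczSector ∧ OffMisiurewiczSector (certifies X
⟺ Schanuel honestly: this is a sector route whose value lies in the ladder below X1). The first
conjunct is restriction; the second: for finite orbit-closed S ⊂ M with ℚ-basis b, e^b is algebraic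
over ℚ(S) = ℚ(b), Schanuel at (b, x) gives trdeg_{ℚ(b,e^b)}(x, eˣ) ≥ n, and an algebraic dependence
over K₀ = ℚ(M) among n of the 2n generators already lives over some ℚ(S) (directed union), so
trdeg_{K₀} ≥ n. [difficulty: M] [Kirby2010EAEF, Lang1966, Waldschmidt2000]
#9 MisiurewiczTransversality (support) — TRANSVERSALITY (Thurston rigidity made infinitesimal): a
Misiurewicz parameter l of exact type (k,p) (`HasPreperiodType l k p`) is a SIMPLE zero of t ↦
a_{k+p}(t) − a_k(t). This is what places every point of M in Kirby's core ecl(∅) with a certified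
non-degenerate Khovanskii format. By hand for k + p ≤ 3 (e.g. type (1,1): derivative λ at λ ∈
2πiℤ∖0; preperiod-2 cells: 2πik(1+λ) ≠ 0); in general from infinitesimal Thurston rigidity / the
lifting property for finite-type maps — the grounder should locate the exact printed statement for
λe^z (Epstein's transversality manuscript, Astorg arXiv:1602.05172, Levin–Shen–van Strien
arXiv:1902.06732 treat neighbouring classes; HubbardSchleicherShishikura2009 gives the Thurston
theory). [difficulty: L] [HubbardSchleicherShishikura2009, arXiv:1902.06732, arXiv:1602.05172,
arXiv:0907.5460]
#9 NoAlgebraicMisiurewiczLowType (support) — the height ≤ 1 point residue is PROVABLE NOW (refuter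
triage-9 addendum on the card): no nonzero algebraic number is a Misiurewicz parameter of type n ≤
3. Cells: (2,1) λ ∈ 2πiℤ∖0 — transcendence of π; (3,1) λe^λ = 2πik — conjugating gives e^{λ−λ̄} =
−λ̄/λ ∈ ℚ̄, so Hermite–Lindemann forces λ real, absurd; (3,2) λ(e^λ − 1) = 2πik — eliminating 2πi
against the conjugate equation gives λe^λ + λ̄e^{λ̄} − (λ+λ̄) = 0 with distinct exponents λ, λ̄, 0
and nonzero algebraic coefficients, contradicting Lindemann–Weierstrass in Baker's form (λ purely
imaginary is excluded separately). Tree facts: transcendental_pi, transcendental_exp (HL),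
linearIndependent_exp (LW), all PROVED. [difficulty: provable-now] [Lindemann1882, Weierstrass1885,
Hermite1873, BakerTNT1975]
#9 KernelPairs (support) — no two shallow special points on a non-special curve: for P ≠ 0 with
algebraic coefficients and no factor Y − rX (r ∈ ℚ), P(πik, πik′) ≠ 0 for all nonzero integers k, k′
(expand P(πik, πik′) = Σ_d (πi)^d P_d(k,k′); transcendence of π kills every homogeneous part; then Y
− (k′/k)X divides P). The (2,1)×(2,1) cell of DAOExp and the arithmetic input that empties the
algebraic part in AddressSparsity. [difficulty: provable-now] [Lindemann1882, BakerTNT1975]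
#9 ShallowHeightOneLines (support) — shallow × height-one on lines: for algebraic a ≠ 0, c with (c ≠
0 or a ∉ ℚ), only finitely many nonzero integers k make μ_k = a·πik + c a Misiurewicz parameter of
type n ≤ 3 (e^{μ_k} = e^c E^k with E = e^{πia}; a ∈ ℚ, c ≠ 0: none by LW in Baker's form after
eliminating π against the conjugate equation; c = 0, a ∉ ℚ: none by Gel'fond–Schneider; a ∉ ℚ, c ≠
0: three solutions give E^{k₁−k₀} = R₁(π), E^{k₂−k₀} = R₂(π) with Möbius R_j over ℚ̄, so (R₁^{d₂} −
R₂^{d₁})(π) = 0 identically, contradicted by the pole of R₁ — at most 2 solutions). [difficulty: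
provable-now] [BakerTNT1975, Gelfond1934, Lindemann1882, Weierstrass1885]
#9 LambertPairsShiftedDiagonal (support) — the first Lambert cell: for algebraic c ≠ 0 only finitely
many λ have λe^λ ∈ 2πiℤ∖0 and (λ+c)e^{λ+c} ∈ 2πiℤ∖0 (dividing, λ = c m e^c/(m′ − m e^c); c real
forces λ real, impossible; c non-real gives e^c ∉ ℝ since Im c ≠ πj by transcendence of π, so |m′ −
m e^c| ≥ |m|·|Im e^c| bounds |λ|, then |m| and m′; λ is determined by (m, m′) — a size argument plus
Hermite–Lindemann only). [difficulty: provable-now] [Lindemann1882, Hermite1873, Bergweiler2016]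

TWO-LAYER PLAN. Foreseen glued splits (none filed now): DAOExp ⇐ LineFiniteness (degree 1, all
depths) → NonlinearCurveFiniteness (degree ≥ 2) → DAOExp
(gen-1's degree split; the two moot items stmt-Schanuel-6476/6479 are revived by re-asking);
AddressSparsity ⇐ TowerDefinability (window trick,
uniform finiteness of fibres) → TwistedTowerAxLindemann (algebraic part = kernel-linear families,
from ax_schanuel_holds) → AddressSparsity
[Pila–Wilkie as a cited named fact in the glue]; HeightOneLines ⇐ DiagonalCells (a = 1) →
RationalSlopeCells → IrrationalSlopeCells;
MisiurewiczSector ⇐ NoAlgebraicMisiurewiczLowType-type cells by height: HeightLeOneSector (all of it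
provable by HL/LW/Baker: x ⊂ span of orbits
of type ≤ 3) → DeepSector.

KILL CRITERIA. OffMisiurewiczSector or MisiurewiczSector refuted = an explicit Schanuel
counterexample (close `refuted:<Decl>`, hand the witness to the summit's
negative side; every route on the summit closes). DAOExp / AddressSparsity / HeightOneLines refuted
by an infinite family of Misiurewicz pairs on a
non-special curve: by SectorGivesEmptiness this is an infinite family of Schanuel counterexamples —
same outcome; refuted instead by a NON-SPECIAL
ALGEBRAIC FAMILY in the algebraic part (a functional identity between twisted towers along an
algebraic arc of addresses) ⇒ restate with the
enlarged special list (misstated, one repair). MisiurewiczTransversality refuted (a multiple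
Misiurewicz zero) kills only the ecl-format support, not
the line. Pivot trigger: the residual HeightOneLines cells shown EQUIVALENT to catalogued open
problems (four exponentials, π ⊥ e^c) ⇒ "finiteness is
easier than emptiness" fails beyond the lattice cells and the route shrinks to AddressSparsity +
supports (close `exhausted` with census, or dormant).
Mooted / regraded `known` if a DAO statement for λe^z (or for finite-type entire families) is found
in print; superseded if a core route
(DiophantineCore, RigidCore) proves a localisation that makes the Misiurewicz span a corollary.

NOT DECOMPOSED YET. The twisted-tower Ax–Lindemann lemma and the definability bookkeeping (children
of AddressSparsity; o-minimality is not in the tree); the card's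
transseries engine E2 as a separate item (enters only when a balanced-regime cell of HeightOneLines
demands it); the ecl-format corollary
"M ⊂ ecl ∅" of MisiurewiczTransversality (needs the Khovanskii-system spelling of towers;
conceptual, not load-bearing); the further localisation of
OffMisiurewiczSector to CORE tuples via Kirby's proved relative theorem (a support
`kirby_relative_schanuel_complex → …` once someone wants it); the
sibling "no CM points / algebraic multiplier" half of the parameter space (card
exp-family-multiplier-no-cm-points, a different special-point notion);
conics and the degree-2 table; the negative-side census (certified enumeration of Misiurewicz
parameters of address height ≤ 50 + LLL against lines
and conics of height ≤ 20) — a kit job any refuter may run against MisiurewiczSector.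
Prior-programme inspiration notes not read (plancard mode).

CHEAPEST FALSIFIER. (1) Lookup (regrades novelty, not truth): any arithmetic statement about
Misiurewicz parameters of λe^z (transcendence, DAO, "1 + 2πi") in
Devaney's handbook chapter (zbl 1255.37001), Schleicher/Rempe surveys, Benini arXiv:0907.5460 — this
session: zbMATH 0 hits for "Schanuel conjecture
Misiurewicz" and "transversality exponential family Misiurewicz", galaxy --star all 0 rows for six
phrasings. (2) Internal logic check (kills the
FRAME if it fails): prove the Assembly on paper in the degenerate case n = 1, z = (1): W = 0, u =
(1), OffMisiurewiczSector gives e transcendental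
over K₀ — consistent (done in NOTES). (3) Numerics (kit, ~1 CPU-h, refuter): Newton-enumerate
Misiurewicz parameters of types ≤ (4,·) with addresses
≤ 30, certify by interval Newton, LLL/PSLQ for integer relations among {1, λ, λ′, λλ′, …} of height
≤ 10^6 on pairs — a persistent 10^-40 relation
off the lines y = r x would be a numerical Schanuel counterexample (refutes MisiurewiczSector); none
is the expected weak corroboration.

NUMBERS. Shallow special points: πiℤ∖0 (even multiples of πi: type (1,1) in Bergweiler's
normalisation, `hasPreperiodType_one_one_iff`; odd: type (2,1),
`hasPreperiodType_pi_mul_I_odd`). Special curves over ℚ̄: y = r x, r ∈ ℚ∖0 (forced by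
MisiurewiczSector: SectorGivesEmptiness).
ShallowHeightOneLines bound: ≤ 2 points per line (0 if a ∈ ℚ or c = 0). Bergweiler2016 Thm 1: #{λ of
exact type (k+l, k), 0 < |λ| ≤ r} ~
f_{k+l−1}(r)·f_{k+l−2}(r)^{1/2}/(2π³)^{1/2} (tower growth) — hence counting by orbit modulus in
AddressSparsity (address height ≤ R/2π + 1,
universe polynomial in R); Pila–Wilkie exponent: any ε > 0. Height ≤ 1 residue: all six type pairs
(n ≤ 3) closed by π/HL/LW
(NoAlgebraicMisiurewiczLowType); the Schanuel-hard residue starts at type (4,1): λe^{λe^λ} ∈ 2πiℤ.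
Items at open: 14 (5 cruxes, 1 assembly, 8 supports).

DEFINITION REQUESTS. None new: `IsPostsingularlyFinite`, `postsingularOrbit`, `HasPreperiodType`,
`orbitModulusLE` landed in
Literature.Dynamics.ExponentialFamily.PostsingularlyFinite (all proved, no named facts; requested by
gen-1). Cite facts wanted later (not now, to keep
the cone free of unproved facts): Pila–Wilkie 2006 Thm 1.8 over an ℝ_an,exp-definability predicate;
LSV2008 main theorem (addresses ↔ Misiurewicz
parameters); a printed transversality theorem for λe^z.

Novelty: Searches (2026-08-15, this planner): zbMATH "transversality critical relations families" (8:
Levin–Shen–van Strien arXiv:1611.10056, 1702.02582,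
1901.09941, 1902.06732 — rational / polynomial-like / classes F, E, E_o; λe^z not treated
explicitly), "postsingularly finite exponential maps" (3:
HubbardSchleicherShishikura2009, Bergweiler2016, LaubnerSchleicherVicol2008 — Thurston theory,
Nevanlinna counting, combinatorics; no arithmetic),
"Misiurewicz exponential parameter space" (3: Devaney handbook 2010, Benini 2011 arXiv:0907.5460
triviality of fibres, Gauthier–Vigny 2019),
"Schanuel conjecture Misiurewicz" (0), "transversality exponential family Misiurewicz" (0); `lit
read arXiv:1902.06732` and `arXiv:1901.09941`
(grep exponential/finite type: finite-type transversality delegated to Epstein ms. and Astorg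
arXiv:1602.05172); `lit frontier Schanuel --since 2021`
(30 rows: unlikely intersections in tori/abelian/Shimura settings, effective Pila–Wilkie
BinyaminiEtAl2026, counting theorems arXiv:2604.15189; no
dynamics); `lit bridges Schanuel --cross any` (no dynamics bridge); `lit galaxy search --star all`
for "Misiurewicz parameters of the exponential
family", "Schanuel conjecture relative to a subfield", "algebraic independence of postsingularly
finite exponential parameters", "Misiurewicz
parameters exponential", "relative Schanuel", "exponential maps transcendence parameters" (0 rows
each); control `--star pdf "Schanuel's conjecture"`
surfaced D'Aquino–Fornasiero–Terzo (Daqui  [refs: 10.1215/00127094-3673996, 10.1090/tran/7206, 1611.10056, 0907.5460, 1902.06732, 1901.09941, 1602.05172, 2604.15189, 1602.02016, 2302.02583, doi:10.1215/00127094-3673996, doi:10.1090/tran/7206, HubbardSchleicherShishikura2009, Bergweiler2016, LaubnerSchleicherVicol2008, BinyaminiEtAl2026, DaquinoFornasieroTerzo2017, GhiocaEtAl2017, BakerDemarco2011]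

Barriers (technique_class: dynamical-andre-oort, o-minimal-counting, relative-sector): - technique_class: dynamical-andre-oort, o-minimal-counting, relative-sector
- Literature.Barriers.Schanuel.AxSchanuelFunctionalNotNumerical: RESPECTED, not evaded — Ax–Schanuel
(ax_schanuel_holds) enters only the FUNCTIONAL step (algebraic part of the address-definable set in
AddressSparsity) and Kirby's relative theorem; no item derives a numerical statement from it; the
point statements are exactly MisiurewiczSector/OffMisiurewiczSector, declared Schanuel-hard, and the
unconditional cells use π, HL, LW, GS, Baker.
- Literature.Barriers.Schanuel.LargeTranscendenceDegree: it does not evade it; the bet is that the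
FAMILY layer (finiteness, sparsity) and the height ≤ 1 cells are provable without large
transcendence degree, while DAOExp's general cell and both sector cruxes sit behind the trdeg ≥ 2
wall (said in their why-it-might-fail).
- Literature.Barriers.Schanuel.AlgebraicIndependenceOfLogarithms: not evaded — OffMisiurewiczSector
contains log-sector statements relative to K₀ (log 2 ∉ ℚ(M)^alg); the route makes no claim there
beyond filing it honestly as the complement.
- Literature.Barriers.Schanuel.LinearSubgroupMethodLimit: not in its class — no auxiliary-function /
linear-subgroup method is proposed; the family layer counts integer points (Pila–Wilkie) and uses
size/reality regimes.
- Literature.Barriers.Schanuel.SchanuelPropertyNotFirstOrder: no model-theoretic transfer of SP is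
used; o-minimality serves only to count integer points of definable sets in the standard r

History (route lifecycle, newest last):
- 2026-08-22T16:51:35Z · DORMANT — reconciler: no traction for 5.5 d (last activity item-evidence-added at 2026-08-17T04:18:53Z); parked, not closed — `ledger route dormant route-Schanuel-Misiure (operator:999:3582205)

sub-problem: Schanuel · status: dormant · opened planner-plancard-Schanuel-Schanuel-exponentia-a461e5e6-g2-0 2026-08-15T18:55:30Z · rev 2 · ledger route-Schanuel-MisiurewiczField
GENERATED by the gate from the ledger (D-0016/17). Provers cite these decls: `theorem foo : Summit.Schanuel.Schanuel.Theses.MisiurewiczField.<Decl> := …` in Summits/Schanuel/Schanuel/Theorems/<Name>.lean.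
-/

namespace Summit.Schanuel.Schanuel.Theses.MisiurewiczField

open scoped BigOperators Topology Manifold Classical MeasureTheory ProbabilityTheory Matrix InnerProductSpace ComplexConjugate ContinuousMap
open Filter Set Function TopologicalSpace MeasureTheory

attribute [summit_statement] _root_.Schanuel

open Literature.Periods

/-- item stmt-Schanuel-12572 · crux · rank 2 · open · by planner
why it might fail: from tower height 2 on (types (4,·) and deeper) these are genuine Schanuel instances about 2πi, W_b(2πik), e^{W…} with no method beyond LW/Baker; one algebraic coincidence between two deep Misiurewicz parameters refutes it (and Schanuel).
sources: DaquinoFornasieroTerzo2017, Kirby2010EAEF, LaubnerSchleicherVicol2008, Waldschmidt2000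
[crux] Schanuel's conjecture for tuples x₁…xₙ in the ℚ-span of the Misiurewicz orbit set M (card
POINT RESIDUE in full; contains orbit freeness, "no two Misiurewicz parameters are algebraically
dependent beyond ℚ-scaling", "1 + 2πik is never Misiurewicz"). [difficulty: open-problem] -/
@[route_item "route-Schanuel-MisiurewiczField", crux]
def MisiurewiczSector : Prop :=
  ∀ (n : ℕ) (x : Fin n → ℂ), (∀ i, x i ∈ Submodule.span ℚ {w : ℂ | ∃ l : ℂ, Literature.Dynamics.ExponentialFamily.IsPostsingularlyFinite l ∧ ∃ j : ℕ, w = Literature.Dynamics.ExponentialFamily.postsingularOrbit l (j + 1)}) → LinearIndependent ℚ x → (n : Cardinal) ≤ Algebra.trdeg ℚ ↥(IntermediateField.adjoin ℚ (Set.range x ∪ Set.range (Complex.exp ∘ x)))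

/-- item stmt-Schanuel-12573 · crux · rank 3 · open · by planner
why it might fail: no Galois orbits: counting gives sparsity only, and off the lattice/size regimes each cell asks to confine many ℚ-independent λ with λ, e^λ algebraic over ℚ(π, e^c) — the trdeg ≥ 2 wall (barrier LargeTranscendenceDegree).
sources: GhiocaEtAl2017, BakerDemarco2011, LaubnerSchleicherVicol2008, Bergweiler2016
[crux] dynamical André–Oort for the exponential family over ℚ̄, FAMILY version (card C1): for P ∈
ℚ̄[X,Y] irreducible, not associated to Y − rX (r ∈ ℚ), X − c or Y − c, only finitely many pairs of
Misiurewicz parameters lie on P = 0 (special curves = lines through 0 of rational slope;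
axis-parallel lines excluded so that no point statement is smuggled in). Strictly below
MisiurewiczSector (SectorGivesEmptiness gives emptiness). [deps: AddressSparsity, HeightOneLines]
[difficulty: open-problem] -/
@[route_item "route-Schanuel-MisiurewiczField"]
def DAOExp : Prop :=
  ∀ P : MvPolynomial (Fin 2) ℂ, Irreducible P → (∀ m, IsAlgebraic ℚ (P.coeff m)) → (∀ r : ℚ, ¬ (MvPolynomial.X 1 - MvPolynomial.C (r : ℂ) * MvPolynomial.X 0 ∣ P)) → (∀ c : ℂ, ¬ (MvPolynomial.X 0 - MvPolynomial.C c ∣ P)) → (∀ c : ℂ, ¬ (MvPolynomial.X 1 - MvPolynomial.C c ∣ P)) → Set.Finite {p : ℂ × ℂ | Literature.Dynamics.ExponentialFamily.IsPostsingularlyFinite p.1 ∧ Literature.Dynamics.ExponentialFamily.IsPostsingularlyFinite p.2 ∧ MvPolynomial.eval ![p.1, p.2] P = 0}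

/-- item stmt-Schanuel-12574 · crux · rank 4 · open · by planner
why it might fail: the algebraic part of Y_P may contain a non-special semialgebraic family of twisted towers carrying integer points (an unforeseen functional identity along an algebraic arc of addresses); and the Lean closure needs o-minimality + Pila–Wilkie, absent from the tree.
sources: PilaWilkie2006, BinyaminiEtAl2026, Pila2022, Ax1971, LaubnerSchleicherVicol2008
[crux] Pila–Wilkie sparsity (card C2) in the orbit-modulus normalisation: for P as in DAOExp, every
d and ε > 0 there is κ with #{(λ,λ′) on P = 0 : both Misiurewicz of type ≤ d with all orbit points
of modulus ≤ R} ≤ κ R^ε for R ≥ 1 (window trick a_j = x_j + i(y_j + 2πb_j) makes type-(n,m)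
parameters the integer points of an ℝ_an,exp-definable set; orbit modulus ≤ R bounds address height;
Pila–Wilkie thins the transcendental part; the algebraic part is classified by an Ax–Lindemann lemma
for twisted towers and emptied by KernelPairs). [deps: KernelPairs] [difficulty: XL] -/
@[route_item "route-Schanuel-MisiurewiczField"]
def AddressSparsity : Prop :=
  ∀ P : MvPolynomial (Fin 2) ℂ, Irreducible P → (∀ m, IsAlgebraic ℚ (P.coeff m)) → (∀ r : ℚ, ¬ (MvPolynomial.X 1 - MvPolynomial.C (r : ℂ) * MvPolynomial.X 0 ∣ P)) → (∀ c : ℂ, ¬ (MvPolynomial.X 0 - MvPolynomial.C c ∣ P)) → (∀ c : ℂ, ¬ (MvPolynomial.X 1 - MvPolynomial.C c ∣ P)) → ∀ d : ℕ, ∀ ε : ℝ, 0 < ε → ∃ κ : ℝ, ∀ R : ℝ, 1 ≤ R → ∃ S : Finset (ℂ × ℂ), (S.card : ℝ) ≤ κ * R ^ ε ∧ ∀ p : ℂ × ℂ, (p.1 ≠ 0 ∧ ∃ m n : ℕ, m < n ∧ n ≤ d ∧ Literature.Dynamics.ExponentialFamily.postsingularOrbit p.1 n = Literature.Dynamics.ExponentialFamily.postsingularOrbit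 p.1 m ∧ Literature.Dynamics.ExponentialFamily.orbitModulusLE p.1 n R) → (p.2 ≠ 0 ∧ ∃ m n : ℕ, m < n ∧ n ≤ d ∧ Literature.Dynamics.ExponentialFamily.postsingularOrbit p.2 n = Literature.Dynamics.ExponentialFamily.postsingularOrbit p.2 m ∧ Literature.Dynamics.ExponentialFamily.orbitModulusLE p.2 n R) → MvPolynomial.eval ![p.1, p.2] P = 0 → p ∈ S

/-- item stmt-Schanuel-12575 · crux · rank 5 · open · by planner
why it might fail: for a ∉ {0,1} the solutions are algebraic over ℚ(π, e^c) but span no lattice, so π-elimination fails and finiteness asks to confine ≥ 3 ℚ-independent λ_j with e^{λ_j} in a trdeg-2 field — Schneider–Lang over a field of finite type with no known transcendence type.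
sources: Waldschmidt2000, BakerTNT1975, Gelfond1934, Bergweiler2016
[crux] the height-one table on lines (card C3): for algebraic a ≠ 0, c with (c ≠ 0 or a ∉ ℚ), only
finitely many λ have both λ and aλ + c Misiurewicz of type n ≤ 3 (λ ∈ πiℤ∖0, or λe^λ ∈ 2πiℤ, or
λ(e^λ − 1) ∈ 2πiℤ). The proved cells ride as supports (ShallowHeightOneLines,
LambertPairsShiftedDiagonal); the residual cells are (3,·)×(3,·) with a ≠ 1: explicit
exponential-Diophantine equations with λ quadratic over ℚ(π, e^c), to be closed by
Lambert/transseries asymptotics in the integer data. [deps: ShallowHeightOneLines,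
LambertPairsShiftedDiagonal] [difficulty: L] -/
@[route_item "route-Schanuel-MisiurewiczField"]
def HeightOneLines : Prop :=
  ∀ a c : ℂ, IsAlgebraic ℚ a → IsAlgebraic ℚ c → a ≠ 0 → (c ≠ 0 ∨ a ∉ Set.range ((↑) : ℚ → ℂ)) → Set.Finite {l : ℂ | (l ≠ 0 ∧ ∃ m n : ℕ, m < n ∧ n ≤ 3 ∧ Literature.Dynamics.ExponentialFamily.postsingularOrbit l n = Literature.Dynamics.ExponentialFamily.postsingularOrbit l m) ∧ (a * l + c ≠ 0 ∧ ∃ m n : ℕ, m < n ∧ n ≤ 3 ∧ Literature.Dynamics.ExponentialFamily.postsingularOrbit (a * l + c) n = Literature.Dynamics.ExponentialFamily.postsingularOrbit (a * l + c) m)}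

/-- item stmt-Schanuel-12576 · crux · rank 6 · open · by planner
why it might fail: it is most of Schanuel (x = (1) says e is transcendental over ℚ(M) ∋ π; x = (log 2) says log 2 ∉ ℚ(M)^alg) and no transcendence method works relative to the infinitely generated base ℚ(M); the route offers no attack on it beyond Kirby's relative theorem.
sources: Kirby2010EAEF, BaysKirby2018, Waldschmidt2000, Lang1966
[crux] Schanuel RELATIVE to the Misiurewicz field K₀ = ℚ(M): if x₁…xₙ ∈ ℂ are ℚ-linearly independent
modulo span_ℚ M then trdeg over K₀ of K₀(x, eˣ) is ≥ n. The complement of the sector (contains: e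
transcendental over K₀ ∋ π; log 2 ∉ K₀^alg); by Kirby's PROVED relative theorem (tree
`kirby_relative_schanuel_complex_holds`) its content is carried by core tuples modulo the
Misiurewicz span. Schanuel ⇒ it (SchanuelGivesSectors) and X1 ∧ it ⇒ Schanuel (Assembly).
[difficulty: open-problem] -/
@[route_item "route-Schanuel-MisiurewiczField", crux]
def OffMisiurewiczSector : Prop :=
  ∀ (n : ℕ) (x : Fin n → ℂ), LinearIndependent ℚ ((Submodule.span ℚ {w : ℂ | ∃ l : ℂ, Literature.Dynamics.ExponentialFamily.IsPostsingularlyFinite l ∧ ∃ j : ℕ, w = Literature.Dynamics.ExponentialFamily.postsingularOrbit l (j + 1)}).mkQ ∘ x) → (n : Cardinal) ≤ Algebra.trdeg ↥(IntermediateField.adjoin ℚ {w : ℂ | ∃ l : ℂ, Literature.Dynamics.ExponentialFamily.IsPostsingularlyFinite l ∧ ∃ j : ℕ, w = Literature.Dynamics.ExponentialFamily.postsingularOrbit l (j + 1)}) ↥(IntermediateField.adjoin ↥(IntermediateField.adjoin ℚ {w : ℂ | ∃ l : ℂ, Literature.Dynamics.ExponentialFamily.IsPostsingularlyFinite l ∧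 ∃ j : ℕ, w = Literature.Dynamics.ExponentialFamily.postsingularOrbit l (j + 1)}) (Set.range x ∪ Set.range (Complex.exp ∘ x)))

/-- item stmt-Schanuel-12577 · support · rank 9 · open · by planner
sources: DaquinoFornasieroTerzo2017, Lang1966, Waldschmidt2000
[support] the point version is forced by the sector: MisiurewiczSector ⇒ for P ≠ 0 with algebraic
coefficients and no factor Y − rX (r ∈ ℚ), NO pair of Misiurewicz parameters lies on P = 0 (so
DAOExp's set is empty, not just finite; P = X − c: no Misiurewicz parameter is algebraic; P = Y − X
− c: no two differ by an algebraic number). Proof: S = the two orbits; e^{a_j} = a_{j+1}/λ ∈ ℚ(S); a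
ℚ-basis x ⊆ S of span S has trdeg ℚ(x) = trdeg ℚ(x, eˣ) ≥ |x| by the sector, so x is algebraically
independent; P(ℓ(x), ℓ′(x)) = 0 for the ℚ-linear forms of λ, λ′ forces ℓ′ = rℓ and (Y − rX) | P.
[difficulty: M] -/
@[route_item "route-Schanuel-MisiurewiczField"]
def SectorGivesEmptiness : Prop :=
  MisiurewiczSector → ∀ P : MvPolynomial (Fin 2) ℂ, P ≠ 0 → (∀ m, IsAlgebraic ℚ (P.coeff m)) → (∀ r : ℚ, ¬ (MvPolynomial.X 1 - MvPolynomial.C (r : ℂ) * MvPolynomial.X 0 ∣ P)) → ∀ l l' : ℂ, Literature.Dynamics.ExponentialFamily.IsPostsingularlyFinite l → Literature.Dynamics.ExponentialFamily.IsPostsingularlyFinite l' → MvPolynomial.eval ![l, l'] P ≠ 0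

/-- item stmt-Schanuel-12578 · support · rank 9 · open · by planner
sources: DaquinoFornasieroTerzo2017, Bergweiler2016
[support] the orbit form of the sector ("the post-singular orbit of a Misiurewicz exponential map is
algebraically free"): MisiurewiczSector ⇒ for l of exact type (k,p), if the distinct orbit points
a_1(l), …, a_{k+p−1}(l) are ℚ-linearly independent they are algebraically independent (e^{a_j} =
a_{j+1}/a_1 ∈ ℚ(a), so trdeg ℚ(a) = trdeg ℚ(a, e^a) ≥ k + p − 1). [difficulty: provable-now] -/
@[route_item "route-Schanuel-MisiurewiczField"]
def OrbitFreenessOfSector : Prop :=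
  MisiurewiczSector → ∀ (l : ℂ) (k p : ℕ), Literature.Dynamics.ExponentialFamily.HasPreperiodType l k p → LinearIndependent ℚ (fun j : Fin (k + p - 1) => Literature.Dynamics.ExponentialFamily.postsingularOrbit l ((j : ℕ) + 1)) → AlgebraicIndependent ℚ (fun j : Fin (k + p - 1) => Literature.Dynamics.ExponentialFamily.postsingularOrbit l ((j : ℕ) + 1))

/-- item stmt-Schanuel-12579 · support · rank 9 · open · by planner
sources: Kirby2010EAEF, Lang1966, Waldschmidt2000
[support] Schanuel ⇒ MisiurewiczSector ∧ OffMisiurewiczSector (certifies X ⟺ Schanuel honestly: this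
is a sector route whose value lies in the ladder below X1). The first conjunct is restriction; the
second: for finite orbit-closed S ⊂ M with ℚ-basis b, e^b is algebraic over ℚ(S) = ℚ(b), Schanuel at
(b, x) gives trdeg_{ℚ(b,e^b)}(x, eˣ) ≥ n, and an algebraic dependence over K₀ = ℚ(M) among n of the
2n generators already lives over some ℚ(S) (directed union), so trdeg_{K₀} ≥ n. [difficulty: M] -/
@[route_item "route-Schanuel-MisiurewiczField"]
def SchanuelGivesSectors : Prop :=
  _root_.Schanuel → MisiurewiczSector ∧ OffMisiurewiczSector

/-- item stmt-Schanuel-12580 · support · rank 9 · open · by planner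
sources: HubbardSchleicherShishikura2009, arXiv:1902.06732, arXiv:1602.05172, arXiv:0907.5460
[support] TRANSVERSALITY (Thurston rigidity made infinitesimal): a Misiurewicz parameter l of exact
type (k,p) (`HasPreperiodType l k p`) is a SIMPLE zero of t ↦ a_{k+p}(t) − a_k(t). This is what
places every point of M in Kirby's core ecl(∅) with a certified non-degenerate Khovanskii format. By
hand for k + p ≤ 3 (e.g. type (1,1): derivative λ at λ ∈ 2πiℤ∖0; preperiod-2 cells: 2πik(1+λ) ≠ 0);
in general from infinitesimal Thurston rigidity / the lifting property for finite-type maps — the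
grounder should locate the exact printed statement for λe^z (Epstein's transversality manuscript,
Astorg arXiv:1602.05172, Levin–Shen–van Strien arXiv:1902.06732 treat neighbouring classes;
HubbardSchleicherShishikura2009 gives the Thurston theory). [difficulty: L] -/
@[route_item "route-Schanuel-MisiurewiczField"]
def MisiurewiczTransversality : Prop :=
  ∀ (l : ℂ) (k p : ℕ), Literature.Dynamics.ExponentialFamily.HasPreperiodType l k p → deriv (fun t : ℂ => Literature.Dynamics.ExponentialFamily.postsingularOrbit t (k + p) - Literature.Dynamics.ExponentialFamily.postsingularOrbit t k) l ≠ 0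

/-- item stmt-Schanuel-12581 · support · rank 9 · open · by planner
sources: Lindemann1882, Weierstrass1885, Hermite1873, BakerTNT1975
[support] the height ≤ 1 point residue is PROVABLE NOW (refuter triage-9 addendum on the card): no
nonzero algebraic number is a Misiurewicz parameter of type n ≤ 3. Cells: (2,1) λ ∈ 2πiℤ∖0 —
transcendence of π; (3,1) λe^λ = 2πik — conjugating gives e^{λ−λ̄} = −λ̄/λ ∈ ℚ̄, so
Hermite–Lindemann forces λ real, absurd; (3,2) λ(e^λ − 1) = 2πik — eliminating 2πi against the
conjugate equation gives λe^λ + λ̄e^{λ̄} − (λ+λ̄) = 0 with distinct exponents λ, λ̄, 0 and nonzero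
algebraic coefficients, contradicting Lindemann–Weierstrass in Baker's form (λ purely imaginary is
excluded separately). Tree facts: transcendental_pi, transcendental_exp (HL), linearIndependent_exp
(LW), all PROVED. [difficulty: provable-now] -/
@[route_item "route-Schanuel-MisiurewiczField"]
def NoAlgebraicMisiurewiczLowType : Prop :=
  ∀ l : ℂ, IsAlgebraic ℚ l → l ≠ 0 → ∀ m n : ℕ, m < n → n ≤ 3 → Literature.Dynamics.ExponentialFamily.postsingularOrbit l n ≠ Literature.Dynamics.ExponentialFamily.postsingularOrbit l m

/-- item stmt-Schanuel-12582 · support · rank 9 · open · by planner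
sources: Lindemann1882, BakerTNT1975
[support] no two shallow special points on a non-special curve: for P ≠ 0 with algebraic
coefficients and no factor Y − rX (r ∈ ℚ), P(πik, πik′) ≠ 0 for all nonzero integers k, k′ (expand
P(πik, πik′) = Σ_d (πi)^d P_d(k,k′); transcendence of π kills every homogeneous part; then Y −
(k′/k)X divides P). The (2,1)×(2,1) cell of DAOExp and the arithmetic input that empties the
algebraic part in AddressSparsity. [difficulty: provable-now] -/
@[route_item "route-Schanuel-MisiurewiczField"]
def KernelPairs : Prop :=
  ∀ P : MvPolynomial (Fin 2) ℂ, P ≠ 0 → (∀ m, IsAlgebraic ℚ (P.coeff m)) → (∀ r : ℚ, ¬ (MvPolynomial.X 1 - MvPolynomial.C (r : ℂ) * MvPolynomial.X 0 ∣ P)) → ∀ k k' : ℤ, k ≠ 0 → k' ≠ 0 → MvPolynomial.eval ![(Real.pi : ℂ) * Complex.I * k, (Real.pi : ℂ) * Complex.I * k'] P ≠ 0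

/-- item stmt-Schanuel-12583 · support · rank 9 · open · by planner
sources: BakerTNT1975, Gelfond1934, Lindemann1882, Weierstrass1885
[support] shallow × height-one on lines: for algebraic a ≠ 0, c with (c ≠ 0 or a ∉ ℚ), only finitely
many nonzero integers k make μ_k = a·πik + c a Misiurewicz parameter of type n ≤ 3 (e^{μ_k} = e^c
E^k with E = e^{πia}; a ∈ ℚ, c ≠ 0: none by LW in Baker's form after eliminating π against the
conjugate equation; c = 0, a ∉ ℚ: none by Gel'fond–Schneider; a ∉ ℚ, c ≠ 0: three solutions give
E^{k₁−k₀} = R₁(π), E^{k₂−k₀} = R₂(π) with Möbius R_j over ℚ̄, so (R₁^{d₂} − R₂^{d₁})(π) = 0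
identically, contradicted by the pole of R₁ — at most 2 solutions). [difficulty: provable-now] -/
@[route_item "route-Schanuel-MisiurewiczField"]
def ShallowHeightOneLines : Prop :=
  ∀ a c : ℂ, IsAlgebraic ℚ a → IsAlgebraic ℚ c → a ≠ 0 → (c ≠ 0 ∨ a ∉ Set.range ((↑) : ℚ → ℂ)) → Set.Finite {k : ℤ | k ≠ 0 ∧ a * ((Real.pi : ℂ) * Complex.I * k) + c ≠ 0 ∧ ∃ m n : ℕ, m < n ∧ n ≤ 3 ∧ Literature.Dynamics.ExponentialFamily.postsingularOrbit (a * ((Real.pi : ℂ) * Complex.I * k) + c) n = Literature.Dynamics.ExponentialFamily.postsingularOrbit (a * ((Real.pi : ℂ) * Complex.I * k) + c) m}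

/-- item stmt-Schanuel-12584 · support · rank 9 · open · by planner
sources: Lindemann1882, Hermite1873, Bergweiler2016
[support] the first Lambert cell: for algebraic c ≠ 0 only finitely many λ have λe^λ ∈ 2πiℤ∖0 and
(λ+c)e^{λ+c} ∈ 2πiℤ∖0 (dividing, λ = c m e^c/(m′ − m e^c); c real forces λ real, impossible; c
non-real gives e^c ∉ ℝ since Im c ≠ πj by transcendence of π, so |m′ − m e^c| ≥ |m|·|Im e^c| bounds
|λ|, then |m| and m′; λ is determined by (m, m′) — a size argument plus Hermite–Lindemann only).
[difficulty: provable-now] -/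
@[route_item "route-Schanuel-MisiurewiczField"]
def LambertPairsShiftedDiagonal : Prop :=
  ∀ c : ℂ, IsAlgebraic ℚ c → c ≠ 0 → Set.Finite {l : ℂ | (∃ m : ℤ, m ≠ 0 ∧ l * Complex.exp l = 2 * (Real.pi : ℂ) * Complex.I * m) ∧ (∃ m : ℤ, m ≠ 0 ∧ (l + c) * Complex.exp (l + c) = 2 * (Real.pi : ℂ) * Complex.I * m)}

/-- item stmt-Schanuel-12585 · assembly · rank 1 · open · by planner
sources: Lang1966, Kirby2010EAEF
[assembly] MisiurewiczSector → OffMisiurewiczSector → Schanuel (basis split of span z against span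
M; e^w algebraic over the Misiurewicz field; tower additivity of transcendence degree). -/
@[route_item "route-Schanuel-MisiurewiczField", crux]
def Assembly : Prop :=
  MisiurewiczSector → OffMisiurewiczSector → _root_.Schanuel

/-! D-0027 §2.1 — DECIDING THEOREM (planner-authored via `route open/edit --closes-file`; by planner-rrepair-Schanuel-MisiurewiczField-5b01e014-0 2026-08-15T19:46:26Z):
its hypotheses are this route's items and its conclusion the sub-problem Statement (glue_lint), and it elaborates with this file. -/

@[closes "route-Schanuel-MisiurewiczField"] theorem closes (hAssembly : Assembly) (hMis : MisiurewiczSector) (hOff : OffMisiurewiczSector) : _root_.Schanuel := by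
  exact hAssembly hMis hOff

end Summit.Schanuel.Schanuel.Theses.MisiurewiczField
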